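import Literature.AnabelianGeometry.SemiGraphs.PSCTwoComponentAffineShape
import Literature.AnabelianGeometry.SemiGraphs.ProSigmaCuspInertiaDisjoint
import HarnessLib

/-!
# [CombGC] Prop. 1.2 (i) at genuine two-component data with cusps: edge-like and unramified cases; all three cases

Mochizuki, *A combinatorial version of the Grothendieck conjecture* [CombGC] §1, Prop. 1.2 (i) p. 8,
edge-like case ("If `A₁ ∩ A₂` is open in `A₁`, then `e₁ = e₂`") [cite: MochizukiCombGC2007, Prop 1.2(i) p.8].
PROOF-ONLY companion of `PSCTwoComponentAffineShape.lean` (abc-iut-f-164 gen 2; row F-0459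
`PSCDatum.OpenInterDeterminesComponentHolds`): the data of TWO-COMPONENT AFFINE SHAPE (two pointed
components `C₀`, `C₁` glued at one node `ν`, at least two marked points on each; `Π` a pro-`Σ` completion
`ι : Γ_{g,r} → Π`, cusp groups `closure ι⟨c_j⟩`, node group `closure ι⟨ε⟩` with
`ε = (c_s ⋯ c_{r−1}) · ∏_{i<g₀}[a_i,b_i]`) are described in that file's docstring.

## The argument (edge-like case)

There is one node, so two nodal subgroups are attached to the same edge.  For the remaining pairs
`(e₁, e₂)`, `e₁ ≠ e₂`, a generator `x` of `γ₁Π_{e₁}γ₁⁻¹` is separated from `γ₂Π_{e₂}γ₂⁻¹` by continuous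
characters `χ : Π → ℤ/ℓⁿ` (`ℓ ∈ Σ`) extending cusp characters of `Γ_{g,r}` (abc-iut-f-165's profinite
pigeonhole `not_isOpen_inf_subgroupOf_of_characters`):
* cusp `c` vs cusp `c' ≠ c`: `c ↦ 1`, `c_k ↦ −1` for a third cusp `k` (there are `r ≥ 4` cusps);
* cusp `c` vs node: `c ↦ 1`, `c_k ↦ −1` with `c_k ≠ c` ON THE SAME COMPONENT, so that the node loop `ε`
  (total weight of the cusps of `C₀`) is killed;
* node vs cusp `c'`: `c_k ↦ 1`, `c_m ↦ −1` with `c_k ≠ c'` on `C₀` and `c_m ≠ c'` on `C₁`, so that `ε ↦ 1`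
  while `c' ↦ 0`.
Each choice uses "at least two marked points on each component".  Unramified case (`G` sturdy, so both
components carry ≥ 2 handles): the handle character `a_0 ↦ 1` resp. `a_{g₀} ↦ 1` kills every cusp group
and the node group, hence `Ker(Π_G ↠ Π^unr_G)` (abc-iut-f-165's `unrKer_le_ker`), and the other vertex
group, while it is `1` on `γ₁ι(a_0)γ₁⁻¹ ∈ γ₁Π_{v₀}γ₁⁻¹ · Ker`.  Then
`openInterDeterminesComponent_of_twoComponentAffine` assembles the verticial
(`PSCTwoComponentAffineShape.lean`), edge-like and unramified cases.  A shape instance is consistency evidence for the typed schema, not the printed theorem for all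
pointed stable curves; nothing here takes a side on [IUTchIII] Cor. 3.12.
-/

noncomputable section

namespace Literature.AnabelianGeometry.SemiGraphs

open scoped Pointwise
open Literature.GroupTheory.CombinatorialGroupTheory
open SemiGraphOfAnabelioids (IsProSigmaCompletion)
open Multiplicative

universe u

namespace PSCDatum

open TwoComponentAffine

variable {P : Type u} [Group P] [TopologicalSpace P] [IsTopologicalGroup P]
variable [CompactSpace P] [TotallyDisconnectedSpace P] {Sigma : Set ℕ} {g r : ℕ}

/-- Engine of the edge-like case: `γ₁ • cl ι⟨z₁⟩ ∩ γ₂ • T` is not open in `γ₁ • cl ι⟨z₁⟩` as soon as,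
for every `n`, some cusp character `φ : Γ_{g,r} → ℤ/ℓⁿ` (handles `↦ 0`) with `φ z₁ = 1` has all its
continuous extensions to `Π` killing `T`. [cite: MochizukiCombGC2007, Prop 1.2(i) p.8] -/
private theorem not_isOpen_of_cuspCharacters {ι : PuncturedSurfaceGroup g r →* P}
    (hι : IsProSigmaCompletion Sigma ι) {ℓ : ℕ}
    (hℓ : ℓ.Prime) (hℓS : ℓ ∈ Sigma) (γ₁ γ₂ : ConjAct P) (z₁ : PuncturedSurfaceGroup g r)
    (T : Subgroup P)
    (h : ∀ n : ℕ, ∃ (wc : Fin r → ZMod (ℓ ^ n)), ∑ k, wc k = 0 ∧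
      ∀ φ : PuncturedSurfaceGroup g r →* Multiplicative (ZMod (ℓ ^ n)),
        (∀ k, φ (PuncturedSurfaceGroup.c k) = ofAdd (wc k)) → φ z₁ = ofAdd 1 ∧
          ∀ χ : P →* Multiplicative (ZMod (ℓ ^ n)), Continuous χ → (∀ γ, χ (ι γ) = φ γ) → T ≤ χ.ker) :
    ¬ IsOpen ((((γ₁ • ((Subgroup.zpowers z₁).map ι).topologicalClosure) ⊓ γ₂ • T).subgroupOf
      (γ₁ • ((Subgroup.zpowers z₁).map ι).topologicalClosure) :
        Subgroup (γ₁ • ((Subgroup.zpowers z₁).map ι).topologicalClosure : Subgroup P)) :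
      Set (γ₁ • ((Subgroup.zpowers z₁).map ι).topologicalClosure : Subgroup P)) := by
  refine not_isOpen_inf_subgroupOf_of_characters hℓ.one_lt _ _ (x := γ₁ • ι z₁)
    (Subgroup.smul_mem_pointwise_smul _ _ _ (Subgroup.le_topologicalClosure _
      (Subgroup.mem_map_of_mem ι (Subgroup.mem_zpowers z₁)))) fun n => ?_
  obtain ⟨wc, hw, hφ⟩ := h n
  obtain ⟨φ, -, -, hφc⟩ := PuncturedSurfaceGroup.exists_handleCuspCharacter (g := g) 0 0 wc hw
  obtain ⟨hz, hT⟩ := hφ φ hφc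
  obtain ⟨χ, hχc, hχ⟩ := exists_continuous_extend_zmod_pow hι hℓ hℓS n φ
  exact ⟨χ, smul_le_ker_of_le_ker (hT χ hχc hχ) γ₂, by rw [map_conjAct_smul_eq_self, hχ, hz]⟩

/-- **[CombGC] Prop. 1.2 (i), edge-like case, at two-component affine shape** (see the module
docstring for the three separating characters; one node, at least two marked points on each component).
[cite: MochizukiCombGC2007, Prop 1.2(i) p.8] -/
theorem edgeLikeOpenInterDeterminesEdge_of_twoComponentAffine (hne : Sigma.Nonempty)
    (hprime : ∀ p ∈ Sigma, p.Prime) (ι : PuncturedSurfaceGroup g r →* P)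
    (hι : IsProSigmaCompletion Sigma ι) (G : PSCDatum P) {g₀ s : ℕ} (hs : 2 ≤ s) (hsr : s + 2 ≤ r)
    (e : G.graph.C ≃ Fin r)
    (hC : ∀ c, G.cuspGp c =
      ((PuncturedSurfaceGroup.cuspInertia (g := g) (e c)).map ι).topologicalClosure)
    (ε : PuncturedSurfaceGroup g r)
    (hε : ε = ((List.finRange r).map fun j : Fin r =>
          if s ≤ (j : ℕ) then PuncturedSurfaceGroup.c (g := g) j else 1).prod *
        ((List.finRange g).map fun i : Fin g => if (i : ℕ) < g₀ then
          PuncturedSurfaceGroup.a (r := r) i * PuncturedSurfaceGroup.b i *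
            (PuncturedSurfaceGroup.a i)⁻¹ * (PuncturedSurfaceGroup.b i)⁻¹ else 1).prod)
    (n₀ : G.graph.N) (hN : ∀ n, n = n₀)
    (hE : G.nodeGp n₀ = ((Subgroup.zpowers ε).map ι).topologicalClosure) :
    G.EdgeLikeOpenInterDeterminesEdge := by
  classical
  obtain ⟨ℓ, hℓS⟩ := hne
  have hℓ : ℓ.Prime := hprime ℓ hℓS
  intro e₁ e₂ γ₁ γ₂ hopen
  by_contra hne12
  rcases e₁ with n₁ | c₁ <;> rcases e₂ with n₂ | c₂
  · exact hne12 (by rw [hN n₁, hN n₂])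
  · -- node vs cusp `c₂`: weight `δ_k - δ_m`, `k ≠ e c₂` on `C₀`, `m ≠ e c₂` on `C₁`
    obtain ⟨k, hk, hkj⟩ : ∃ k : Fin r, s ≤ (k : ℕ) ∧ k ≠ e c₂ := by
      by_cases h : ((e c₂ : Fin r) : ℕ) = s
      · exact ⟨⟨s + 1, by omega⟩, by simp, fun h' => absurd (congrArg Fin.val h') (by simp; omega)⟩
      · exact ⟨⟨s, by omega⟩, by simp, fun h' => absurd (congrArg Fin.val h') (by simp; omega)⟩
    obtain ⟨m', hm', hmj⟩ : ∃ m' : Fin r, ¬ s ≤ (m' : ℕ) ∧ m' ≠ e c₂ := by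
      by_cases h : ((e c₂ : Fin r) : ℕ) = 0
      · exact ⟨⟨1, by omega⟩, by simp; omega,
          fun h' => absurd (congrArg Fin.val h') (by simp; omega)⟩
      · exact ⟨⟨0, by omega⟩, by simp; omega,
          fun h' => absurd (congrArg Fin.val h') (by simp; omega)⟩
    have hopen' := hopen
    change IsOpen ((((γ₁ • G.nodeGp n₁) ⊓ γ₂ • G.cuspGp c₂).subgroupOf (γ₁ • G.nodeGp n₁) :
      Subgroup (γ₁ • G.nodeGp n₁ : Subgroup P)) : Set (γ₁ • G.nodeGp n₁ : Subgroup P)) at hopen'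
    rw [hN n₁, hE, hC, PuncturedSurfaceGroup.cuspInertia] at hopen'
    refine not_isOpen_of_cuspCharacters hι hℓ hℓS γ₁ γ₂ ε _ (fun n => ?_) hopen'
    refine ⟨fun l => (if l = k then 1 else 0) + (if l = m' then -1 else 0), sum_twoDelta k m',
      fun φ hφc => ⟨?_, fun χ hχc hχ => ?_⟩⟩
    · rw [hε, character_nodeLoop φ hφc, sum_ite_twoDelta, if_pos hk, if_neg hm', add_zero]
    · refine topologicalClosure_map_zpowers_le_ker ι χ hχc _ ?_
      rw [hχ, hφc]
      simp [hkj.symm, hmj.symm]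
  · -- cusp `c₁` vs node: weight `δ_j - δ_k`, `k ≠ j = e c₁` on the same component
    obtain ⟨k, hkj, hk⟩ : ∃ k : Fin r, k ≠ e c₁ ∧ (s ≤ (k : ℕ) ↔ s ≤ ((e c₁ : Fin r) : ℕ)) := by
      by_cases hj : s ≤ ((e c₁ : Fin r) : ℕ)
      · by_cases h : ((e c₁ : Fin r) : ℕ) = s
        · exact ⟨⟨s + 1, by omega⟩, fun h' => absurd (congrArg Fin.val h') (by simp; omega),
            by simp; omega⟩
        · exact ⟨⟨s, by omega⟩, fun h' => absurd (congrArg Fin.val h') (by simp; omega),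
            by simp; omega⟩
      · by_cases h : ((e c₁ : Fin r) : ℕ) = 0
        · exact ⟨⟨1, by omega⟩, fun h' => absurd (congrArg Fin.val h') (by simp; omega),
            by simp; omega⟩
        · exact ⟨⟨0, by omega⟩, fun h' => absurd (congrArg Fin.val h') (by simp; omega),
            by simp; omega⟩
    have hopen' := hopen
    change IsOpen ((((γ₁ • G.cuspGp c₁) ⊓ γ₂ • G.nodeGp n₂).subgroupOf (γ₁ • G.cuspGp c₁) :
      Subgroup (γ₁ • G.cuspGp c₁ : Subgroup P)) : Set (γ₁ • G.cuspGp c₁ : Subgroup P)) at hopen'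
    rw [hN n₂, hE, hC, PuncturedSurfaceGroup.cuspInertia] at hopen'
    refine not_isOpen_of_cuspCharacters hι hℓ hℓS γ₁ γ₂ _ _ (fun n => ?_) hopen'
    refine ⟨fun l => (if l = e c₁ then 1 else 0) + (if l = k then -1 else 0), sum_twoDelta (e c₁) k,
      fun φ hφc => ⟨by rw [hφc]; simp [hkj.symm], fun χ hχc hχ => ?_⟩⟩
    refine topologicalClosure_map_zpowers_le_ker ι χ hχc _ ?_
    rw [hχ, hε, character_nodeLoop φ hφc, sum_ite_twoDelta]
    by_cases hj : s ≤ ((e c₁ : Fin r) : ℕ)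
    · rw [if_pos hj, if_pos (hk.mpr hj)]; simp
    · rw [if_neg hj, if_neg (fun h' => hj (hk.mp h'))]; simp
  · -- cusp vs cusp: a third cusp
    by_cases hc : c₁ = c₂
    · exact hne12 (by rw [hc])
    have hj : e c₁ ≠ e c₂ := fun h => hc (e.injective h)
    obtain ⟨k, hk1, hk2⟩ :=
      SemiGraphOfAnabelioids.exists_third_cusp (by omega : 3 ≤ r) (e c₁) (e c₂)
    have hopen' := hopen
    change IsOpen ((((γ₁ • G.cuspGp c₁) ⊓ γ₂ • G.cuspGp c₂).subgroupOf (γ₁ • G.cuspGp c₁) :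
      Subgroup (γ₁ • G.cuspGp c₁ : Subgroup P)) : Set (γ₁ • G.cuspGp c₁ : Subgroup P)) at hopen'
    rw [hC, hC, PuncturedSurfaceGroup.cuspInertia, PuncturedSurfaceGroup.cuspInertia] at hopen'
    refine not_isOpen_of_cuspCharacters hι hℓ hℓS γ₁ γ₂ _ _ (fun n => ?_) hopen'
    refine ⟨fun l => (if l = e c₁ then 1 else 0) + (if l = k then -1 else 0), sum_twoDelta (e c₁) k,
      fun φ hφc => ⟨by rw [hφc]; simp [hk1.symm], fun χ hχc hχ => ?_⟩⟩
    refine topologicalClosure_map_zpowers_le_ker ι χ hχc _ ?_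
    rw [hχ, hφc]
    simp [hj.symm, hk2.symm]

/-! ### Prop. 1.2 (i), unramified case -/

/-- **[CombGC] Prop. 1.2 (i), unramified case (`G` sturdy), at two-component affine shape.**  For `G`
sturdy both components carry at least two handles; the continuous extension of the handle character
`a_0 ↦ 1` (every other generator `↦ 0`) to `ℤ/ℓⁿ` kills every cusp group and the node group — hence the
closed normal subgroup `Ker(Π_G ↠ Π^unr_G)` they generate (abc-iut-f-165's `unrKer_le_ker`) — and every
generator of `Π_{v₁}`, while it is `1` on `γ₁ι(a_0)γ₁⁻¹ ∈ γ₁Π_{v₀}γ₁⁻¹`; symmetrically with `a_{g₀} ↦ 1`.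
Conclude by the profinite pigeonhole `not_isOpen_inf_subgroupOf_of_characters`.
[cite: MochizukiCombGC2007, Prop 1.2(i) p.8] -/
theorem unrVerticialOpenInterDeterminesVertex_of_twoComponentAffine (hne : Sigma.Nonempty)
    (hprime : ∀ p ∈ Sigma, p.Prime) (ι : PuncturedSurfaceGroup g r →* P)
    (hι : IsProSigmaCompletion Sigma ι) (G : PSCDatum P) {g₀ s : ℕ} (hg₀ : g₀ ≤ g)
    (e : G.graph.C ≃ Fin r)
    (hC : ∀ c, G.cuspGp c =
      ((PuncturedSurfaceGroup.cuspInertia (g := g) (e c)).map ι).topologicalClosure)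
    (v₀ v₁ : G.graph.V) (hV : ∀ w, w = v₀ ∨ w = v₁) (ε : PuncturedSurfaceGroup g r)
    (hε : ε = ((List.finRange r).map fun j : Fin r =>
          if s ≤ (j : ℕ) then PuncturedSurfaceGroup.c (g := g) j else 1).prod *
        ((List.finRange g).map fun i : Fin g => if (i : ℕ) < g₀ then
          PuncturedSurfaceGroup.a (r := r) i * PuncturedSurfaceGroup.b i *
            (PuncturedSurfaceGroup.a i)⁻¹ * (PuncturedSurfaceGroup.b i)⁻¹ else 1).prod)
    (hV₀ : G.vertGp v₀ = ((Subgroup.closure {x : PuncturedSurfaceGroup g r |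
        (∃ i : Fin g, (i : ℕ) < g₀ ∧ (x = PuncturedSurfaceGroup.a i ∨ x = PuncturedSurfaceGroup.b i)) ∨
        ∃ j : Fin r, s ≤ (j : ℕ) ∧ x = PuncturedSurfaceGroup.c j}).map ι).topologicalClosure)
    (hV₁ : G.vertGp v₁ = ((Subgroup.closure {x : PuncturedSurfaceGroup g r |
        (∃ i : Fin g, g₀ ≤ (i : ℕ) ∧ (x = PuncturedSurfaceGroup.a i ∨ x = PuncturedSurfaceGroup.b i)) ∨
        (∃ j : Fin r, (j : ℕ) < s ∧ x = PuncturedSurfaceGroup.c j) ∨ x = ε}).map ι).topologicalClosure)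
    (n₀ : G.graph.N) (hN : ∀ n, n = n₀)
    (hE : G.nodeGp n₀ = ((Subgroup.zpowers ε).map ι).topologicalClosure)
    (hgen₀ : G.genus v₀ = g₀) (hgen₁ : G.genus v₁ = g - g₀) :
    G.UnrVerticialOpenInterDeterminesVertex := by
  classical
  obtain ⟨ℓ, hℓS⟩ := hne
  have hℓ : ℓ.Prime := hprime ℓ hℓS
  intro hst v w γ₁ γ₂ hopen
  by_contra hvw
  have h0 : 2 ≤ g₀ := hgen₀ ▸ hst v₀
  have h1 : 2 ≤ g - g₀ := hgen₁ ▸ hst v₁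
  -- a handle character (all cusps `↦ 0`) kills the node loop, every cusp group and the node group
  have hunr : ∀ {n : ℕ} (φ : PuncturedSurfaceGroup g r →* Multiplicative (ZMod n)),
      (∀ k, φ (PuncturedSurfaceGroup.c k) = ofAdd ((0 : Fin r → ZMod n) k)) →
      ∀ χ : P →* Multiplicative (ZMod n), Continuous χ → (∀ γ, χ (ι γ) = φ γ) →
        φ ε = 1 ∧ G.unrKer ≤ χ.ker := by
    intro n φ hφc χ hχc hχ
    have hφε : φ ε = 1 := by rw [hε, character_nodeLoop φ hφc]; simp
    refine ⟨hφε, G.unrKer_le_ker χ hχc (fun c => ?_) (fun n' => ?_)⟩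
    · rw [hC, PuncturedSurfaceGroup.cuspInertia]
      exact topologicalClosure_map_zpowers_le_ker ι χ hχc _ (by rw [hχ, hφc]; rfl)
    · rw [hN n', hE]
      exact topologicalClosure_map_zpowers_le_ker ι χ hχc _ (by rw [hχ, hφε])
  rcases hV v with hv | hv <;> rcases hV w with hw | hw
  · exact hvw (hv.trans hw.symm)
  · -- `v = v₀`, `w = v₁`: the handle `a_0` of `C₀`
    rw [hv, hw] at hopen
    let i₀ : Fin g := ⟨0, by omega⟩
    refine not_isOpen_inf_subgroupOf_of_characters hℓ.one_lt (γ₁ • G.vertGp v₀ ⊔ G.unrKer)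
      (γ₂ • G.vertGp v₁ ⊔ G.unrKer) (x := γ₁ • ι (PuncturedSurfaceGroup.a i₀))
      (Subgroup.mem_sup_left (Subgroup.smul_mem_pointwise_smul _ _ _ ?_)) (fun m => ?_) hopen
    · rw [hV₀]
      exact Subgroup.le_topologicalClosure _ (Subgroup.mem_map_of_mem ι (Subgroup.subset_closure
        (Or.inl ⟨i₀, by change 0 < g₀; omega, Or.inl rfl⟩)))
    · let wa : Fin g → ZMod (ℓ ^ m) := fun i => if i = i₀ then 1 else 0
      obtain ⟨φ, hφa, hφb, hφc⟩ :=
        PuncturedSurfaceGroup.exists_handleCuspCharacter (r := r) wa 0 0 (by simp)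
      obtain ⟨χ, hχc, hχ⟩ := exists_continuous_extend_zmod_pow hι hℓ hℓS m φ
      obtain ⟨hφε, hK⟩ := hunr φ hφc χ hχc hχ
      refine ⟨χ, sup_le ?_ hK, by rw [map_conjAct_smul_eq_self, hχ, hφa]; simp [wa]⟩
      rw [hV₁]
      refine smul_le_ker_of_le_ker (topologicalClosure_map_closure_le_ker ι χ hχc _ ?_) γ₂
      rintro y (⟨i, hi, (rfl | rfl)⟩ | ⟨j, -, rfl⟩ | rfl)
      · have hi0 : i ≠ i₀ := fun h => by
          have := congrArg Fin.val h
          simp only [i₀] at this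
          omega
        rw [hχ, hφa]
        simp [wa, hi0]
      · rw [hχ, hφb]; rfl
      · rw [hχ, hφc]; rfl
      · rw [hχ, hφε]
  · -- `v = v₁`, `w = v₀`: the handle `a_{g₀}` of `C₁`
    rw [hv, hw] at hopen
    let i₁ : Fin g := ⟨g₀, by omega⟩
    refine not_isOpen_inf_subgroupOf_of_characters hℓ.one_lt (γ₁ • G.vertGp v₁ ⊔ G.unrKer)
      (γ₂ • G.vertGp v₀ ⊔ G.unrKer) (x := γ₁ • ι (PuncturedSurfaceGroup.a i₁))
      (Subgroup.mem_sup_left (Subgroup.smul_mem_pointwise_smul _ _ _ ?_)) (fun m => ?_) hopen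
    · rw [hV₁]
      exact Subgroup.le_topologicalClosure _ (Subgroup.mem_map_of_mem ι (Subgroup.subset_closure
        (Or.inl ⟨i₁, by change g₀ ≤ g₀; exact le_rfl, Or.inl rfl⟩)))
    · let wa : Fin g → ZMod (ℓ ^ m) := fun i => if i = i₁ then 1 else 0
      obtain ⟨φ, hφa, hφb, hφc⟩ :=
        PuncturedSurfaceGroup.exists_handleCuspCharacter (r := r) wa 0 0 (by simp)
      obtain ⟨χ, hχc, hχ⟩ := exists_continuous_extend_zmod_pow hι hℓ hℓS m φ
      obtain ⟨-, hK⟩ := hunr φ hφc χ hχc hχ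
      refine ⟨χ, sup_le ?_ hK, by rw [map_conjAct_smul_eq_self, hχ, hφa]; simp [wa]⟩
      rw [hV₀]
      refine smul_le_ker_of_le_ker (topologicalClosure_map_closure_le_ker ι χ hχc _ ?_) γ₂
      rintro y (⟨i, hi, (rfl | rfl)⟩ | ⟨j, -, rfl⟩)
      · have hi1 : i ≠ i₁ := fun h => by
          have := congrArg Fin.val h
          simp only [i₁] at this
          omega
        rw [hχ, hφa]
        simp [wa, hi1]
      · rw [hχ, hφb]; rfl
      · rw [hχ, hφc]; rfl
  · exact hvw (hv.trans hw.symm)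

/-- **[CombGC] Prop. 1.2 (i) — all three cases — at every datum of two-component affine shape** (at least
two marked points on each component; the unramified case for sturdy data, i.e. `g₀, g − g₀ ≥ 2`).
[cite: MochizukiCombGC2007, Prop 1.2(i) p.8] -/
theorem openInterDeterminesComponent_of_twoComponentAffine (hne : Sigma.Nonempty)
    (hprime : ∀ p ∈ Sigma, p.Prime) (ι : PuncturedSurfaceGroup g r →* P)
    (hι : IsProSigmaCompletion Sigma ι) (G : PSCDatum P) {g₀ s : ℕ} (hg₀ : g₀ ≤ g) (hs : 2 ≤ s)
    (hsr : s + 2 ≤ r) (e : G.graph.C ≃ Fin r)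
    (hC : ∀ c, G.cuspGp c =
      ((PuncturedSurfaceGroup.cuspInertia (g := g) (e c)).map ι).topologicalClosure)
    (v₀ v₁ : G.graph.V) (hV : ∀ w, w = v₀ ∨ w = v₁) (ε : PuncturedSurfaceGroup g r)
    (hε : ε = ((List.finRange r).map fun j : Fin r =>
          if s ≤ (j : ℕ) then PuncturedSurfaceGroup.c (g := g) j else 1).prod *
        ((List.finRange g).map fun i : Fin g => if (i : ℕ) < g₀ then
          PuncturedSurfaceGroup.a (r := r) i * PuncturedSurfaceGroup.b i *
            (PuncturedSurfaceGroup.a i)⁻¹ * (PuncturedSurfaceGroup.b i)⁻¹ else 1).prod)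
    (hV₀ : G.vertGp v₀ = ((Subgroup.closure {x : PuncturedSurfaceGroup g r |
        (∃ i : Fin g, (i : ℕ) < g₀ ∧ (x = PuncturedSurfaceGroup.a i ∨ x = PuncturedSurfaceGroup.b i)) ∨
        ∃ j : Fin r, s ≤ (j : ℕ) ∧ x = PuncturedSurfaceGroup.c j}).map ι).topologicalClosure)
    (hV₁ : G.vertGp v₁ = ((Subgroup.closure {x : PuncturedSurfaceGroup g r |
        (∃ i : Fin g, g₀ ≤ (i : ℕ) ∧ (x = PuncturedSurfaceGroup.a i ∨ x = PuncturedSurfaceGroup.b i)) ∨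
        (∃ j : Fin r, (j : ℕ) < s ∧ x = PuncturedSurfaceGroup.c j) ∨ x = ε}).map ι).topologicalClosure)
    (n₀ : G.graph.N) (hN : ∀ n, n = n₀)
    (hE : G.nodeGp n₀ = ((Subgroup.zpowers ε).map ι).topologicalClosure)
    (hgen₀ : G.genus v₀ = g₀) (hgen₁ : G.genus v₁ = g - g₀) :
    G.VerticialOpenInterDeterminesVertex ∧ G.EdgeLikeOpenInterDeterminesEdge ∧
      G.UnrVerticialOpenInterDeterminesVertex :=
  ⟨G.verticialOpenInterDeterminesVertex_of_twoComponentAffine hne hprime ι hι hs hsr v₀ v₁ hV ε hε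
      hV₀ hV₁,
    G.edgeLikeOpenInterDeterminesEdge_of_twoComponentAffine hne hprime ι hι hs hsr e hC ε hε n₀ hN hE,
    G.unrVerticialOpenInterDeterminesVertex_of_twoComponentAffine hne hprime ι hι hg₀ e hC v₀ v₁ hV ε
      hε hV₀ hV₁ n₀ hN hE hgen₀ hgen₁⟩

end PSCDatum

end Literature.AnabelianGeometry.SemiGraphs

end
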